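import Mathlib.MeasureTheory.Measure.Doubling
import Mathlib.MeasureTheory.Covering.DensityTheorem
import Mathlib.MeasureTheory.Measure.WithDensity
import Literature.Geometry.MetricEmbeddings.HeisenbergKoranyi
import HarnessLib

/-!
# Haar measure of `(ℍ, d_K)`: scaling under dilations, volume of Korányi balls, doubling

Family `pnp`, layer `Literature/Geometry/MetricEmbeddings`; sibling proofs file (theorems only) of
`HeisenbergKoranyi.lean` (`HeisK` = the continuous Heisenberg group with the Cygan–Korányi metric
`d_K`, Haar measure `volume` = Lebesgue measure `L₃` in the coordinates `(x,y,z)`, dilations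
`HeisK.dilate s (x,y,z) = (sx, sy, s²z)`). Source: J. Cheeger, B. Kleiner, A. Naor,
arXiv:0910.2026 = Acta Math. 207 (2011), §1.1: "the map `A_R((a,b,c)) = (Ra,Rb,R²c)` is an
automorphism of `ℍ`. It is also a homothety of the metric `d^ℍ`", Remark 1.4: "The metric spaces
`(ℍ,d^ℍ)` and `(ℍ(ℤ),d_T)` are doubling. (To see this, use for example, the left invariance of
`d^ℍ` and the homotheties `A_R`.)", and the normalisation `L₃(B_r(x)) ≍ r⁴` used throughout
[CKN §§2–4] (e.g. the factors `r⁻⁴` in the total nonconvexity/nonmonotonicity, §4). These are the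
measure-theoretic preliminaries of [CKN Thm. 1.1] on the concrete model `HeisK`.

PROVED here (no named facts):

* `HeisK.map_dilate_volume`: `(δ_s)_* L₃ = |s|⁻⁴ · L₃` (`s ≠ 0`; in coordinates `δ_s` is the
  diagonal linear map `diag(s, s, s²)` of determinant `s⁴` — homogeneous dimension `4`), and
  `HeisK.volume_preimage_dilate`;
* `HeisK.volume_ball`: `L₃(B_r(x)) = r⁴ · L₃(B_1(1))` for all `x ∈ ℍ`, `r > 0` (left-invariance,
  proved in `HeisenbergKoranyi.lean`, and dilations), with `0 < L₃(B_1(1)) < ∞`;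
  `HeisK.volume_closedBall` (the same for closed balls, by continuity) and `HeisK.volume_sphere`
  (Korányi spheres are null);
* `HeisK.isCompact_closedBall'`, `HeisK.properSpace`: closed Korányi balls are compact (closed,
  and bounded in coordinates: `|x|,|y| ≤ R`, `|z| ≤ R²` on `B̄_R(1)`), so `(ℍ, d_K)` is proper;
* `HeisK.isUnifLocDoublingMeasure_volume`: Haar measure is uniformly locally doubling
  (constant `3⁴ = 81`), whence Mathlib's Vitali covering / Lebesgue differentiation machinery
  (`IsUnifLocDoublingMeasure.vitaliFamily`) applies to `(ℍ, d_K, L₃)`;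
* `HeisK.ae_tendsto_measure_inter_div`, `HeisK.ae_tendsto_average`: the **Lebesgue density and
  differentiation theorems** on `(ℍ, d_K, L₃)` along shrinking Korányi balls containing the point
  ("for almost all `x ∈ U` (with respect to Haar measure)", [CKN Thm. 1.1, §7]), obtained from
  Mathlib's doubling-measure Vitali family (`HeisK` is second countable and `L₃` locally finite).

NOT here: the exact constant `L₃(B_1(1))`, Hausdorff dimension `4`.

## References

* [CheegerKleinerNaor2011] J. Cheeger, B. Kleiner, A. Naor, Acta Math. 207 (2011) 291–373, §1.1
  and Rem. 1.4 (arXiv:0910.2026 pp. 5–6).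
* [Cygan1981] J. Cygan, Proc. AMS 83 (1981) 69–70.
-/

noncomputable section

open MeasureTheory MeasureTheory.Measure Metric Filter
open scoped ENNReal NNReal Topology

namespace Literature.Geometry.MetricEmbeddings

namespace HeisK

/-- In coordinates, the dilation `δ_s` is the linear map `(t₁,t₂,t₃) ↦ (s t₁, s t₂, s² t₃)` of
determinant `s⁴`: it maps Lebesgue measure to `|s|⁻⁴ ·` Lebesgue measure.
[cite: CheegerKleinerNaor2011, §1.1] -/
theorem map_coord_dilate_volume {s : ℝ} (hs : s ≠ 0) :
    Measure.map (fun t : ℝ × ℝ × ℝ => (s * t.1, s * t.2.1, s ^ 2 * t.2.2)) volume =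
      ENNReal.ofReal (|s|⁻¹ ^ 4) • (volume : Measure (ℝ × ℝ × ℝ)) := by
  have hs2 : s ^ 2 ≠ 0 := pow_ne_zero 2 hs
  have e : (fun t : ℝ × ℝ × ℝ => (s * t.1, s * t.2.1, s ^ 2 * t.2.2)) =
      Prod.map (fun a : ℝ => s * a) (Prod.map (fun a : ℝ => s * a) (fun a : ℝ => s ^ 2 * a)) := rfl
  rw [e, Measure.volume_eq_prod, Measure.volume_eq_prod,
    ← Measure.map_prod_map _ _ (measurable_const_mul s)
      ((measurable_const_mul s).prodMap (measurable_const_mul _)),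
    ← Measure.map_prod_map _ _ (measurable_const_mul s) (measurable_const_mul _),
    Real.map_volume_mul_left hs, Real.map_volume_mul_left hs2]
  simp only [Measure.prod_smul_left, Measure.prod_smul_right, smul_smul]
  congr 1
  rw [← ENNReal.ofReal_mul (abs_nonneg _), ← ENNReal.ofReal_mul (by positivity)]
  congr 1
  rw [abs_inv, abs_inv, abs_pow]
  field_simp

/-- Dilations are continuous. [cite: CheegerKleinerNaor2011, §1.1] -/
theorem continuous_dilate (s : ℝ) : Continuous (dilate s) := by
  have e : dilate s = homeomorphProd.symm ∘
      (fun t : ℝ × ℝ × ℝ => (s * t.1, s * t.2.1, s ^ 2 * t.2.2)) ∘ homeomorphProd := by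
    funext p
    rfl
  have hD : Continuous fun t : ℝ × ℝ × ℝ => (s * t.1, s * t.2.1, s ^ 2 * t.2.2) := by fun_prop
  rw [e]
  exact homeomorphProd.symm.continuous.comp (hD.comp homeomorphProd.continuous)

/-- Dilations are measurable. [cite: CheegerKleinerNaor2011, §1.1] -/
theorem measurable_dilate (s : ℝ) : Measurable (dilate s) := (continuous_dilate s).measurable

/-- **Haar measure scales by `s⁴` under the dilation `δ_s`**: `(δ_s)_* L₃ = |s|⁻⁴ L₃`
(`L₃(δ_s A) = |s|⁴ L₃(A)`, homogeneous dimension `4`). [cite: CheegerKleinerNaor2011, §1.1] -/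
theorem map_dilate_volume {s : ℝ} (hs : s ≠ 0) :
    Measure.map (dilate s) (volume : Measure HeisK) = ENNReal.ofReal (|s|⁻¹ ^ 4) • volume := by
  have hconj : dilate s = measurableEquivProd.symm ∘
      (fun t : ℝ × ℝ × ℝ => (s * t.1, s * t.2.1, s ^ 2 * t.2.2)) ∘ measurableEquivProd := by
    funext p
    rfl
  have hD : MeasurePreserving (fun t : ℝ × ℝ × ℝ => (s * t.1, s * t.2.1, s ^ 2 * t.2.2))
      (volume : Measure (ℝ × ℝ × ℝ)) (ENNReal.ofReal (|s|⁻¹ ^ 4) • volume) :=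
    ⟨by fun_prop, map_coord_dilate_volume hs⟩
  have := (measurePreserving_equivProd_symm.smul_measure (ENNReal.ofReal (|s|⁻¹ ^ 4))).comp
    (hD.comp measurePreserving_equivProd)
  rw [hconj]
  exact this.map_eq

/-- `L₃(δ_s⁻¹ A) = |s|⁻⁴ L₃(A)`. [cite: CheegerKleinerNaor2011, §1.1] -/
theorem volume_preimage_dilate {s : ℝ} (hs : s ≠ 0) {A : Set HeisK} (hA : MeasurableSet A) :
    volume (dilate s ⁻¹' A) = ENNReal.ofReal (|s|⁻¹ ^ 4) * volume A := by
  rw [← Measure.map_apply (measurable_dilate s) hA, map_dilate_volume hs, Measure.smul_apply,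
    smul_eq_mul]

/-- `δ_s⁻¹ B_{sr}(1) = B_r(1)` (`s > 0`). [cite: CheegerKleinerNaor2011, §1.1] -/
theorem preimage_dilate_ball {s : ℝ} (hs : 0 < s) (r : ℝ) :
    dilate s ⁻¹' ball (1 : HeisK) (s * r) = ball 1 r := by
  ext p
  simp only [Set.mem_preimage, Metric.mem_ball]
  have h : dist (dilate s p) 1 = s * dist p 1 := by
    conv_lhs => rw [← dilate_one s, dist_dilate, abs_of_pos hs]
  rw [h]
  exact mul_lt_mul_iff_right₀ hs

/-- **Volume of Korányi balls**: `L₃(B_r(1)) = r⁴ L₃(B_1(1))`. [cite: CheegerKleinerNaor2011, §1.1] -/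
theorem volume_ball_one {r : ℝ} (hr : 0 < r) :
    volume (ball (1 : HeisK) r) = ENNReal.ofReal (r ^ 4) * volume (ball (1 : HeisK) 1) := by
  have h := volume_preimage_dilate (inv_ne_zero hr.ne') (measurableSet_ball (x := (1 : HeisK))
    (ε := 1))
  have hpre := preimage_dilate_ball (inv_pos.mpr hr) r
  rw [inv_mul_cancel₀ hr.ne'] at hpre
  rw [hpre, abs_of_pos (inv_pos.mpr hr), inv_inv] at h
  exact h

/-- Balls about `x` are left translates of balls about `1`: `B_r(x) = (x⁻¹·)⁻¹ B_r(1)`.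
[cite: CheegerKleinerNaor2011, §1.1] -/
theorem ball_eq_preimage_mul_left (x : HeisK) (r : ℝ) :
    ball x r = (fun p => x⁻¹ * p) ⁻¹' ball 1 r := by
  ext p
  simp only [Set.mem_preimage, Metric.mem_ball]
  rw [← dist_mul_left x⁻¹ p x, inv_mul_cancel]

/-- Closed balls about `x` are left translates of closed balls about `1`.
[cite: CheegerKleinerNaor2011, §1.1] -/
theorem closedBall_eq_image_mul_left (x : HeisK) (r : ℝ) :
    closedBall x r = (fun p => x * p) '' closedBall 1 r := by
  ext p
  simp only [Set.mem_image, Metric.mem_closedBall]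
  constructor
  · intro hp
    refine ⟨x⁻¹ * p, ?_, by rw [mul_inv_cancel_left]⟩
    rwa [← dist_mul_left x⁻¹ p x, inv_mul_cancel] at hp
  · rintro ⟨q, hq, rfl⟩
    rwa [← dist_mul_left x q 1, mul_one] at hq

/-- **`L₃(B_r(x)) = r⁴ L₃(B_1(1))`** for every `x ∈ ℍ`, `r > 0` (left-invariance and dilations).
[cite: CheegerKleinerNaor2011, §1.1] -/
theorem volume_ball (x : HeisK) {r : ℝ} (hr : 0 < r) :
    volume (ball x r) = ENNReal.ofReal (r ^ 4) * volume (ball (1 : HeisK) 1) := by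
  rw [ball_eq_preimage_mul_left, measure_preimage_mul, volume_ball_one hr]

/-- Coordinates of the closed Korányi ball `B̄_R(1)` are bounded: `|x|, |y| ≤ R`, `|z| ≤ R²`.
[cite: Cygan1981, p. 69] -/
theorem coord_bounds_of_mem_closedBall {R : ℝ} {p : HeisK} (hp : p ∈ closedBall (1 : HeisK) R) :
    |p.x| ≤ R ∧ |p.y| ≤ R ∧ |p.z| ≤ R ^ 2 := by
  rw [Metric.mem_closedBall, dist_comm, dist_one_left] at hp
  have hx := (abs_x_le_gauge p).trans hp
  have hy := (abs_y_le_gauge p).trans hp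
  have hv := abs_vert_le_gauge_sq p
  have hg2 : gauge p ^ 2 ≤ R ^ 2 := pow_le_pow_left₀ (gauge_nonneg p) hp 2
  refine ⟨hx, hy, ?_⟩
  have hxy : |p.x * p.y| ≤ R ^ 2 := by
    rw [abs_mul, sq]
    exact mul_le_mul hx hy (abs_nonneg _) ((abs_nonneg _).trans hx)
  have h2 : |2 * p.z| ≤ |2 * p.z - p.x * p.y| + |p.x * p.y| := by
    have := abs_add_le (2 * p.z - p.x * p.y) (p.x * p.y)
    rwa [sub_add_cancel] at this
  rw [abs_mul, abs_two] at h2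
  nlinarith

/-- **Closed Korányi balls are compact** (closed, and bounded in coordinates).
[cite: CheegerKleinerNaor2011, §1.1] -/
theorem isCompact_closedBall_one (R : ℝ) : IsCompact (closedBall (1 : HeisK) R) := by
  have hsub : homeomorphProd '' closedBall (1 : HeisK) R ⊆
      Set.Icc (-R) R ×ˢ (Set.Icc (-R) R ×ˢ Set.Icc (-(R ^ 2)) (R ^ 2)) := by
    rintro _ ⟨p, hp, rfl⟩
    obtain ⟨hx, hy, hz⟩ := coord_bounds_of_mem_closedBall hp
    rw [abs_le] at hx hy hz
    simp only [homeomorphProd_apply, Set.mem_prod, Set.mem_Icc]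
    exact ⟨hx, hy, hz⟩
  have hK : IsCompact (Set.Icc (-R) R ×ˢ (Set.Icc (-R) R ×ˢ Set.Icc (-(R ^ 2)) (R ^ 2))) :=
    isCompact_Icc.prod (isCompact_Icc.prod isCompact_Icc)
  have h1 : IsCompact (homeomorphProd '' closedBall (1 : HeisK) R) :=
    hK.of_isClosed_subset (homeomorphProd.isClosed_image.mpr isClosed_closedBall) hsub
  exact homeomorphProd.isCompact_image.mp h1

/-- Every closed Korányi ball is compact. [cite: CheegerKleinerNaor2011, §1.1] -/
theorem isCompact_closedBall' (x : HeisK) (R : ℝ) : IsCompact (closedBall x R) := by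
  rw [closedBall_eq_image_mul_left]
  exact (isCompact_closedBall_one R).image (continuous_const.mul continuous_id)

/-- **`(ℍ, d_K)` is a proper metric space.** [cite: CheegerKleinerNaor2011, §1.1] -/
theorem properSpace : ProperSpace HeisK :=
  .of_isCompact_closedBall_of_le 0 fun x r _ => isCompact_closedBall' x r

/-- `0 < L₃(B_1(1))`. [cite: CheegerKleinerNaor2011, §1.1] -/
theorem volume_ball_one_pos : 0 < volume (ball (1 : HeisK) 1) :=
  Metric.measure_ball_pos volume 1 one_pos

/-- `L₃(B_1(1)) < ∞`. [cite: CheegerKleinerNaor2011, §1.1] -/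
theorem volume_ball_one_lt_top : volume (ball (1 : HeisK) 1) < ∞ :=
  (measure_mono ball_subset_closedBall).trans_lt (isCompact_closedBall_one 1).measure_lt_top

/-- Korányi balls have finite Haar measure. [cite: CheegerKleinerNaor2011, §1.1] -/
theorem volume_ball_lt_top (x : HeisK) (r : ℝ) : volume (ball x r) < ∞ :=
  (measure_mono ball_subset_closedBall).trans_lt (isCompact_closedBall' x r).measure_lt_top

/-- **Haar measure on `(ℍ, d_K)` is uniformly locally doubling** (constant `81 = 3⁴`:
`L₃(B̄_{2ε}(x)) ≤ L₃(B_{3ε}(x)) = 81 L₃(B_ε(x)) ≤ 81 L₃(B̄_ε(x))`); "The metric spaces `(ℍ,d^ℍ)`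
and `(ℍ(ℤ),d_T)` are doubling. (To see this, use for example, the left invariance of `d^ℍ` and
the homotheties `A_R`.)" [cite: CheegerKleinerNaor2011, §1.1 Rem. 1.4] -/
theorem isUnifLocDoublingMeasure_volume : IsUnifLocDoublingMeasure (volume : Measure HeisK) := by
  refine ⟨⟨81, eventually_nhdsWithin_of_forall fun ε (hε : 0 < ε) x => ?_⟩⟩
  have h81 : ENNReal.ofReal ((3 * ε) ^ 4) = 81 * ENNReal.ofReal (ε ^ 4) := by
    rw [mul_pow, ENNReal.ofReal_mul (by positivity), show ((3 : ℝ) ^ 4) = (81 : ℕ) by norm_num,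
      ENNReal.ofReal_natCast]
    rfl
  calc volume (closedBall x (2 * ε)) ≤ volume (ball x (3 * ε)) :=
        measure_mono (closedBall_subset_ball (by linarith))
    _ = 81 * (ENNReal.ofReal (ε ^ 4) * volume (ball (1 : HeisK) 1)) := by
        rw [volume_ball x (by linarith), h81, mul_assoc]
    _ = 81 * volume (ball x ε) := by rw [volume_ball x hε]
    _ ≤ (81 : ℝ≥0) * volume (closedBall x ε) := by
        rw [ENNReal.coe_ofNat]
        gcongr
        exact ball_subset_closedBall

/-! ### Closed balls and spheres -/

/-- The closed Korányi ball is the intersection of the open balls of radii `r + 1/(n+1)`.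
[cite: CheegerKleinerNaor2011, §1.1] -/
theorem closedBall_eq_iInter_ball (x : HeisK) (r : ℝ) :
    closedBall x r = ⋂ n : ℕ, ball x (r + 1 / ((n : ℝ) + 1)) := by
  ext p
  simp only [mem_closedBall, Set.mem_iInter, mem_ball]
  constructor
  · intro h n
    have : (0 : ℝ) < 1 / ((n : ℝ) + 1) := by positivity
    linarith
  · intro h
    by_contra hcon
    rw [not_le] at hcon
    obtain ⟨n, hn⟩ := exists_nat_one_div_lt (sub_pos.mpr hcon)
    have := h n
    linarith

/-- **Spheres are Haar-null; closed Korányi balls have volume `r⁴ L₃(B_1(1))`** (`r > 0`), by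
continuity of `s ↦ s⁴` (compare `volume_ball`). [cite: CheegerKleinerNaor2011, §1.1] -/
theorem volume_closedBall (x : HeisK) {r : ℝ} (hr : 0 < r) :
    volume (closedBall x r) = ENNReal.ofReal (r ^ 4) * volume (ball (1 : HeisK) 1) := by
  set V := volume (ball (1 : HeisK) 1) with hV
  have hVtop : V ≠ ∞ := volume_ball_one_lt_top.ne
  set s : ℕ → Set HeisK := fun n => ball x (r + 1 / ((n : ℝ) + 1)) with hs
  have hpos : ∀ n : ℕ, (0 : ℝ) < r + 1 / ((n : ℝ) + 1) := fun n => by positivity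
  have hanti : Antitone s := by
    intro m n hmn
    apply ball_subset_ball
    have hm : (0 : ℝ) < (m : ℝ) + 1 := by positivity
    have hmn' : (m : ℝ) ≤ n := by exact_mod_cast hmn
    have := one_div_le_one_div_of_le hm (by linarith : (m : ℝ) + 1 ≤ (n : ℝ) + 1)
    linarith
  have hlim1 : Tendsto (fun n => volume (s n)) atTop (𝓝 (volume (⋂ n, s n))) :=
    tendsto_measure_iInter_atTop (fun n => measurableSet_ball.nullMeasurableSet) hanti
      ⟨0, (volume_ball_lt_top x _).ne⟩
  rw [← closedBall_eq_iInter_ball] at hlim1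
  have hlim2 : Tendsto (fun n => volume (s n)) atTop (𝓝 (ENNReal.ofReal (r ^ 4) * V)) := by
    have hseq : (fun n => volume (s n)) =
        fun n : ℕ => ENNReal.ofReal ((r + 1 / ((n : ℝ) + 1)) ^ 4) * V := by
      funext n
      exact volume_ball x (hpos n)
    rw [hseq]
    have hreal : Tendsto (fun n : ℕ => (r + 1 / ((n : ℝ) + 1)) ^ 4) atTop (𝓝 (r ^ 4)) := by
      have h0 : Tendsto (fun n : ℕ => r + 1 / ((n : ℝ) + 1)) atTop (𝓝 (r + 0)) :=
        tendsto_const_nhds.add tendsto_one_div_add_atTop_nhds_zero_nat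
      rw [add_zero] at h0
      exact h0.pow 4
    exact ENNReal.Tendsto.mul_const (ENNReal.tendsto_ofReal hreal) (Or.inr hVtop)
  exact tendsto_nhds_unique hlim1 hlim2

/-- Korányi spheres are Haar-null. [cite: CheegerKleinerNaor2011, §1.1] -/
theorem volume_sphere (x : HeisK) {r : ℝ} (hr : 0 < r) : volume (sphere x r) = 0 := by
  rw [← closedBall_sdiff_ball, measure_sdiff ball_subset_closedBall measurableSet_ball.nullMeasurableSet
    (volume_ball_lt_top x r).ne, volume_closedBall x hr, volume_ball x hr, tsub_self]

/-! ### Lebesgue density and differentiation on `(ℍ, d_K, L₃)` -/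

/-- `ℍ` is second countable (homeomorphic to `ℝ³`). [cite: CheegerKleinerNaor2011, §1.1] -/
theorem secondCountableTopology : SecondCountableTopology HeisK :=
  homeomorphProd.secondCountableTopology

/-- Haar measure on `ℍ` is locally finite (Korányi balls have finite measure).
[cite: CheegerKleinerNaor2011, §1.1] -/
theorem isLocallyFiniteMeasure_volume : IsLocallyFiniteMeasure (volume : Measure HeisK) :=
  ⟨fun x => ⟨ball x 1, ball_mem_nhds x one_pos, volume_ball_lt_top x 1⟩⟩

/-- **Lebesgue density theorem on `(ℍ, d_K, L₃)`**: for every set `S ⊆ ℍ` and `L₃`-a.e. `x ∈ S`,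
`L₃(S ∩ B̄_{δ_j}(w_j))/L₃(B̄_{δ_j}(w_j)) → 1` along any family of closed Korányi balls with
`δ_j → 0⁺` and `x ∈ B̄_{Kδ_j}(w_j)` (in particular along `B̄_r(x)`, `r → 0⁺`) — the sense of
"at most locations" / "for almost all `x`" in [CKN]. [cite: CheegerKleinerNaor2011, §1.1 Thm. 1.1] -/
theorem ae_tendsto_measure_inter_div (S : Set HeisK) (K : ℝ) :
    ∀ᵐ x ∂(volume : Measure HeisK).restrict S,
      ∀ {ι : Type*} {l : Filter ι} (w : ι → HeisK) (δ : ι → ℝ) (_ : Tendsto δ l (𝓝[>] 0))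
        (_ : ∀ᶠ j in l, x ∈ closedBall (w j) (K * δ j)),
        Tendsto (fun j => volume (S ∩ closedBall (w j) (δ j)) / volume (closedBall (w j) (δ j)))
          l (𝓝 1) := by
  haveI := secondCountableTopology
  haveI := isLocallyFiniteMeasure_volume
  haveI := isUnifLocDoublingMeasure_volume
  exact IsUnifLocDoublingMeasure.ae_tendsto_measure_inter_div volume S K

/-- **Lebesgue differentiation theorem on `(ℍ, d_K, L₃)`**: for a locally integrable `f` and
`L₃`-a.e. `x`, the averages `⨍_{B̄_{δ_j}(w_j)} f dL₃ → f(x)` along closed Korányi balls with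
`δ_j → 0⁺`, `x ∈ B̄_{Kδ_j}(w_j)`. [cite: CheegerKleinerNaor2011, §1.1 Thm. 1.1] -/
theorem ae_tendsto_average {E : Type*} [NormedAddCommGroup E] [NormedSpace ℝ E] [CompleteSpace E]
    {f : HeisK → E} (hf : LocallyIntegrable f (volume : Measure HeisK)) (K : ℝ) :
    ∀ᵐ x ∂(volume : Measure HeisK),
      ∀ {ι : Type*} {l : Filter ι} (w : ι → HeisK) (δ : ι → ℝ) (_ : Tendsto δ l (𝓝[>] 0))
        (_ : ∀ᶠ j in l, x ∈ closedBall (w j) (K * δ j)),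
        Tendsto (fun j => ⨍ y in closedBall (w j) (δ j), f y ∂volume) l (𝓝 (f x)) := by
  haveI := secondCountableTopology
  haveI := isLocallyFiniteMeasure_volume
  haveI := isUnifLocDoublingMeasure_volume
  exact IsUnifLocDoublingMeasure.ae_tendsto_average volume hf K

/-- Density along the centred balls `B̄_r(x)`, `r → 0⁺` (the case `w_j = x`, `K = 1`).
[cite: CheegerKleinerNaor2011, §1.1 Thm. 1.1] -/
theorem ae_tendsto_measure_inter_closedBall_div (S : Set HeisK) :
    ∀ᵐ x ∂(volume : Measure HeisK).restrict S,
      Tendsto (fun r => volume (S ∩ closedBall x r) / volume (closedBall x r)) (𝓝[>] 0) (𝓝 1) := by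
  filter_upwards [ae_tendsto_measure_inter_div S 1] with x hx
  refine hx (fun _ => x) id tendsto_id ?_
  filter_upwards [self_mem_nhdsWithin] with r (hr : 0 < r)
  rw [one_mul]
  exact mem_closedBall_self hr.le

end HeisK

end Literature.Geometry.MetricEmbeddings

end
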